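import Mathlib
import Summits.Langlands.Langlands.Theses.OdlyzkoWorldSplit

/-! # OdlyzkoWorldSplit — proof of the glue item of the gen-2 RESPLIT of `AutomorphyLifting` (= Lift_w, stmt-Langlands-24016) into
`IrreducibleLargePrimeLifting ∧ IrreducibleSmallPrimeLifting ∧ CyclotomicReducibleOrdinaryLifting ∧ CyclotomicReducibleNonOrdinaryRankTwoLifting ∧
CyclotomicReducibleNonOrdinaryHigherRankLifting` (lens-5-g9 node `SlopeRankSplit`).  Pure logic: strong induction on the rank n (`Nat.strong_induction_on`; the
induction hypothesis IS the inlined hypothesis «Lift_w at every rank m < n» of each child, passed as `ih` without restating it) + `Nat.lt_or_ge ℓ (2(n+1))` +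
excluded middle on the image dial and on the slope dial (both by `by_contra` / anonymous `fun hc =>`, so NO dial is ever restated — robust to the gate's
rendering) + `Nat.lt_or_ge n 3`.  To land as `Summits/Langlands/Langlands/Theorems/OdlyzkoWorldSplitAutomorphyLiftingOfSlopesplit.lean` once the edit has
created the glue item `OdlyzkoWorldSplit.AutomorphyLifting_of_slopesplit : Prop := IrreducibleLargePrimeLifting → IrreducibleSmallPrimeLifting →
CyclotomicReducibleOrdinaryLifting → CyclotomicReducibleNonOrdinaryRankTwoLifting → CyclotomicReducibleNonOrdinaryHigherRankLifting → AutomorphyLifting`. -/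

set_option linter.dupNamespace false -- project-wide option; `Summit.Langlands.Langlands` is the mandated namespace

namespace Summit.Langlands.Langlands.Theorems

open Summit.Langlands.Langlands.Theses

/-- A† → F† → RPO → RNO₂ → RNO₃ → Lift_w. -/
theorem AutomorphyLifting_of_slopesplit_proof : OdlyzkoWorldSplit.AutomorphyLifting_of_slopesplit := by
  intro hA hF hPO h2 h3 K hFK hNK n
  revert K
  induction n using Nat.strong_induction_on with
  | _ n ih =>
    intro K _ _ hcpt hn ℓ _ ι ρ
    by_contra hno
    refine hno (hPO K n hcpt hn ih ℓ ι ρ (fun hc => ?_) ?_)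
    · rcases Nat.lt_or_ge ℓ (2 * (n + 1)) with hlt | hge
      · exact hno (hF K n hcpt hn ih ℓ ι ρ hlt hc)
      · exact hno (hA K n hcpt hn ih ℓ ι ρ hge hc)
    · by_contra hnpo
      rcases Nat.lt_or_ge n 3 with hlt3 | hge3
      · refine hno (h2 K n hcpt hn (Nat.le_of_lt_succ hlt3) ih ℓ ι ρ (fun hc => ?_) hnpo)
        rcases Nat.lt_or_ge ℓ (2 * (n + 1)) with hlt | hge
        · exact hno (hF K n hcpt hn ih ℓ ι ρ hlt hc)
        · exact hno (hA K n hcpt hn ih ℓ ι ρ hge hc)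
      · refine hno (h3 K n hcpt hn hge3 ih ℓ ι ρ (fun hc => ?_) hnpo)
        rcases Nat.lt_or_ge ℓ (2 * (n + 1)) with hlt | hge
        · exact hno (hF K n hcpt hn ih ℓ ι ρ hlt hc)
        · exact hno (hA K n hcpt hn ih ℓ ι ρ hge hc)

end Summit.Langlands.Langlands.Theorems
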